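import Summits.BirchSwinnertonDyer.Rank1Residual.X10.ResidualSelmerGeneratorTest
import Summits.BirchSwinnertonDyer.Rank1Residual.X10.TateQuadraticFormsOdd
import Mathlib.Algebra.Module.ZMod
import HarnessLib

/-!
# The N2 parity law (P) and the generator test (G) in GROUP CURRENCY: `p`-torsion abelian groups,
# subgroups, bi-additive `ℤ/p`-valued local pairings — the shape of the tree's Galois-cohomology data
# (cell `b2b-bsdres`, unit `b2b-bsdres-x10` = N2 class lead, GEN 31; TOOL — theorems only, no
# definition, no named fact, nothing booked; file 5 of the GEN 30/31 toolkit: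
# `SelmerStructureSum` → `ResidualSelmerParity` → `ResidualSelmerGeneratorTest`, `TateQuadraticFormsOdd`,
# THIS bridge and its (G) companion `ResidualSelmerGeneratorTestGroupForm` — the last abstract layer before
# the `E[p]` instance of `P-INSTANCE-SPEC-x10g30.md`)

HONEST FRAMING (run/shared/lean/b2b/bsd-rank1-residual/, verbatim in every file): the goal of the
cell is to DELETE the COMBINATION-SHAPED residual classes of the Birch–Swinnerton-Dyer formula for
ALL analytic-rank `≤ 1` elliptic curves over `ℚ` — "full BSD formula for every rank `≤ 1` curve in
class `C`" assembled STRICTLY from published theorems — so that the rank-`≤ 1` remainder becomes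
exactly the CONSTRUCTION-SHAPED classes, which are TYPED (missing-input `Prop`s), NOT attempted.
This is not "finishing BSD". Class X10b (= N2) keeps its label CONSTRUCTION-SHAPED (NEEDS `X_A3`,
referee R82.3 / RESIDUAL-MAP §I N2); this file is a TOOL; no mark / label / tier / count moves.

## What, and why this currency

Files 1–4 (x10 GEN 30) prove Mazur–Rubin 2007 Prop. 1.3 (i) / Thm. 1.4 and the N2 laws (P), (C1), (C2),
(G) over the tree's ABSTRACT quadratic Selmer structures (KMR 2013 §3, `QuadraticSelmerStructure.lean`:
`F`-vector spaces, `F`-linear `loc`, `F`-bilinear pairings). The tree's Galois cohomology is in GROUP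
currency: `galoisCohomology ρ 1` is an abelian group (team n1011 takes `[Module (ZMod p) ·]` only as an
instance ARGUMENT via `AddCommGroup.zmodModule`), `galoisCohomology.localization` is an `AddMonoidHom`,
`unramifiedSubgroup` / `kummerLocalConditionAt` are `AddSubgroup`s, `localTatePairingZMod ρ n v (inv v)`
is bi-additive into `ZMod n`, and the Poitou–Tate inputs (`LocalInvariants.IsPerfect`,
`SumLocalTermEqZero`, `UnramifiedOrthogonal`, `SelmerComplement` — the ONE named fact
`poitouTate_selmerStructure_duality`) are elementwise. This file restates (P) and (G) in exactly that
currency, so that the `E[p]` instance (`HOME/class-closure/N2/P-INSTANCE-SPEC-x10g30.md`, glue G1–G9)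
is an APPLICATION of the theorems below, every hypothesis a tree theorem or a conjunct of the fact:
data `H`, `L v` (finite) killed by the odd prime `p`, `loc v : H →+ L v`, subgroups `Λ v` (unramified)
and `X v` (the local conditions on `S`; `Λ v` off `S`), bi-additive `b v : L v →+ L v →+ ZMod p`
(local Tate pairing ∘ Weil self-duality); inputs `hsymm` (`e_p` alternating, KMR Thm. 3.1 (i)), `hnd`
(local duality), `hΛ` (`Λ v` its own annihilator off `S₀`, Milne I 2.6), `hX` (`X v` its own
annihilator on `S`, MR07 Prop. 2.1 / KMR Lemma 5.3), `hrec` (`∑_{v ∈ S'} b_v(c_v, d_v) = 0` for global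
`c, d` unramified outside `S' ⊇ S₀` — `Im β¹ ⊆ Ker γ¹`, `SumLocalTermEqZero`), `hPT` (a family
`(y_v)_{v ∈ S}` annihilating `loc_S(H_S)` IS a `loc_S x`, `x ∈ H_S` — `Ker γ¹ ⊆ Im β¹`, `SelmerComplement`
with `𝓕 = ⊥|_S ≤ 𝓖 = ⊤|_S`), `hfin` (`H_S` finite, tree `H1UnramifiedFinite`); residual data
`S₀ ⊆ P ⊆ S`, `T ⊆ S \ P`, `X v = Λ v` on `S \ (P ∪ T)` (tree (L1), `p ∤ c_v`), LOCAL TERM ONE in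
index form `#X_v = p · #(X_v ∩ Λ_v)` on `T`; the groups `Sel`, `S⁰` by MEMBERSHIP (so the instance
plugs in the tree's own Selmer groups): `Sel = {c : loc_v c ∈ X_v (v ∈ S), ∈ Λ_v (v ∉ S)}`,
`S⁰ = {c : loc_v c ∈ X_v (v ∈ P), ∈ Λ_v (v ∉ P)}`. Conclusions: (P) `even_add_add_card_groupForm`
(`#Sel = p^s`, `#S⁰ = p^{s₀}` ⟹ `s + s₀ + #T` even), `ne_bot_of_odd_groupForm`, both through the common engine
`even_and_generatorTest_groupForm`, whose (G) half (`#Sel = p`, one exceptional `v₀`, a non-zero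
`c ∈ Sel`: `loc_{v₀} c ∉ Λ_{v₀}` ⟹ `S⁰ = ⊥`, `∈` ⟹ `#S⁰ = p²`) is unpacked in file 6
`X10/ResidualSelmerGeneratorTestGroupForm.lean`. §1 is the packaging
(`AddMonoidHom.toZModLinearMap`, `AddSubgroup.toZModSubmodule`, `exists_bilinForm_eq`,
`exists_structures` = file 4's `ofPairings` / `ofSelfDual` on the group data with `IsSelfDualAt`
DERIVED from `hrec` + `hPT`). `p` odd enters once (`2 ≠ 0` in `𝔽_p`, KMR Lemma 3.4).

## References

* [MazurRubin2007] B. Mazur, K. Rubin, *Finding large Selmer rank via an arithmetic theory of local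
  constants*, Ann. of Math. 166 (2007), Def. 1.2, Prop. 1.3, Thm. 1.4, Prop. 2.1 — arXiv:math/0512085
  pp. 5–6, read.
* [KlagsbrunMazurRubin2013] Z. Klagsbrun, B. Mazur, K. Rubin, Ann. of Math. 178 (2013), §3 (Thm. 3.1,
  Def. 3.3, Lemma 3.4, Def. 3.8, Thm. 3.9), §5 (Lemma 5.3) — arXiv:1111.2321, read.
* [MilneADT2006] J. S. Milne, *Arithmetic Duality Theorems*, I Cor. 2.3, Thm. 2.6, Thm. 4.10 (the
  tree's `PoitouTateSelmerStructures.lean`).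
* HOME/class-closure/N2/{TRIVIAL-ROADS-x10g27.md §1, P-SPEC-x10g29.md, P-INSTANCE-SPEC-x10g30.md};
  HOME/X10-AUDIT.md §§33–37.
-/

set_option autoImplicit false

noncomputable section

open Module QuadraticMap Literature.LinearAlgebra.QuadraticForm Literature.NumberTheory.EllipticCurves
open Summit.BirchSwinnertonDyer.Rank1Residual.X10.SelmerStructureSum
open Summit.BirchSwinnertonDyer.Rank1Residual.X10.ResidualSelmerParity
open Summit.BirchSwinnertonDyer.Rank1Residual.X10.ResidualSelmerGeneratorTest
open Summit.BirchSwinnertonDyer.Rank1Residual.X10.TateQuadraticFormsOdd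

namespace Summit.BirchSwinnertonDyer.Rank1Residual.X10.ResidualSelmerParityGroupForm

universe v w x

/-! ### §1. Packaging: `p`-torsion groups as `𝔽_p`-spaces, bi-additive pairings as bilinear forms -/

section Packaging

variable {p : ℕ} [hp : Fact p.Prime] {M : Type w} [AddCommGroup M] [Module (ZMod p) M]

/-- A bi-additive `ZMod p`-valued pairing on a `ZMod p`-module is a bilinear form (the scalar action is
through `ℤ`). [folklore] -/
theorem exists_bilinForm_eq (b : M →+ M →+ ZMod p) :
    ∃ B : LinearMap.BilinForm (ZMod p) M, ∀ x y, B x y = b x y :=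
  ⟨((AddMonoidHom.toZModLinearMapEquiv p).toAddMonoidHom.comp b).toZModLinearMap p, fun _ _ => rfl⟩

/-- A submodule and a subgroup with the same members have the same order. [folklore] -/
theorem natCard_eq_of_forall_mem_iff {N : Submodule (ZMod p) M} {A : AddSubgroup M}
    (h : ∀ c, c ∈ N ↔ c ∈ A) : Nat.card N = Nat.card A :=
  Nat.card_congr (Equiv.subtypeEquivRight h)

/-- LOCAL TERM ONE in index form: `#X = p · #(X ∩ Y)` ⟹ `dim X = dim (X ∩ Y) + 1`. [folklore] -/
theorem finrank_eq_finrank_inf_add_one_of_natCard [Finite M] {X Y : Submodule (ZMod p) M}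
    (h : Nat.card X = p * Nat.card ↥(X ⊓ Y)) : finrank (ZMod p) X = finrank (ZMod p) ↥(X ⊓ Y) + 1 := by
  have e1 := Literature.GroupTheory.FiniteAbelian.pow_finrank_eq_natCard p X
  have e2 := Literature.GroupTheory.FiniteAbelian.pow_finrank_eq_natCard p ↥(X ⊓ Y)
  rw [h, ← e2, ← pow_succ'] at e1
  exact Nat.pow_right_injective hp.out.two_le e1

/-- `𝔽_p` has `2 ≠ 0` for `p ≠ 2`; a local copy of the folklore step (the tree's
`BinaryQuartic.two_ne_zero_zmod` lives in an unrelated elliptic-curve file). [folklore] -/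
private theorem two_ne_zero_zmod' (hp2 : p ≠ 2) : (2 : ZMod p) ≠ 0 := by
  intro h
  have h' : ((2 : ℕ) : ZMod p) = 0 := by exact_mod_cast h
  rw [ZMod.natCast_eq_zero_iff] at h'
  exact hp2 ((Nat.prime_dvd_prime_iff_eq hp.out Nat.prime_two).mp h')

end Packaging

/-! ### §1'. The KMR structure of the group data (module currency, instances as arguments) -/

section Structures

variable {p : ℕ} [hp : Fact p.Prime] {ι : Type v} [DecidableEq ι] {H : Type w} [AddCommGroup H]
  [Module (ZMod p) H] {L : ι → Type x} [∀ v, AddCommGroup (L v)] [∀ v, Module (ZMod p) (L v)]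

/-- **The global metabolic structure and the self-dual Selmer structure of the group data** (KMR
Lemma 3.4 / Def. 3.8 via file 4's `ofPairings` / `ofSelfDual`), with the Poitou–Tate input
`IsSelfDualAt S` DERIVED from the two elementwise halves `hrec` (image ⊆ annihilator) and `hPT`
(annihilator ⊆ image), and finite dimension of the classes unramified outside `S` from their
finiteness. Stated as an existence so that no definition is introduced; the local conditions of `𝒮`
are `X v` on `S` and `Λ v` off `S`. [cite: KlagsbrunMazurRubin2013, Lemma 3.4 and Def. 3.8]
[cite: MazurRubin2007, Def. 1.2] -/
theorem exists_structures (hp2 : p ≠ 2) (loc : ∀ v, H →ₗ[ZMod p] L v)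
    (Λ : ∀ v, Submodule (ZMod p) (L v)) (B : ∀ v, LinearMap.BilinForm (ZMod p) (L v))
    {S₀ S : Finset ι} (hS₀ : S₀ ⊆ S) (X : ∀ v, Submodule (ZMod p) (L v))
    (hsymm : ∀ v x y, B v x y = B v y x) (hnd : ∀ v x, (∀ y, B v x y = 0) → x = 0)
    (hΛ : ∀ v, v ∉ S₀ → ∀ x, x ∈ Λ v ↔ ∀ y ∈ Λ v, B v x y = 0)
    (hX : ∀ v ∈ S, ∀ x, x ∈ X v ↔ ∀ y ∈ X v, B v x y = 0)
    (hrec : ∀ S' : Finset ι, S₀ ⊆ S' → ∀ c d : H, (∀ v, v ∉ S' → loc v c ∈ Λ v) →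
      (∀ v, v ∉ S' → loc v d ∈ Λ v) → ∑ v ∈ S', B v (loc v c) (loc v d) = 0)
    (hPT : ∀ y : ∀ v, L v, (∀ c : H, (∀ v, v ∉ S → loc v c ∈ Λ v) →
      ∑ v ∈ S, B v (loc v c) (y v) = 0) → ∃ c : H, (∀ v, v ∉ S → loc v c ∈ Λ v) ∧ ∀ v ∈ S, loc v c = y v)
    (hfin : Finite {c : H // ∀ v, v ∉ S → loc v c ∈ Λ v}) :
    ∃ 𝓆 : GlobalMetabolicStructure loc Λ S₀, ∃ 𝒮 : QuadraticSelmerStructure 𝓆,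
      𝓆.IsSelfDualAt S ∧ 𝒮.places = S ∧ (∀ v ∈ S, 𝒮.W v = X v) ∧
        FiniteDimensional (ZMod p) (unramifiedOutside loc Λ S) := by
  have h2 : (2 : ZMod p) ≠ 0 := two_ne_zero_zmod' hp2
  have hsymm' : ∀ v, (B v).IsSymm := fun v => LinearMap.BilinForm.isSymm_def.mpr (hsymm v)
  -- self-annihilating, in Mathlib's `orthogonal` words
  have horth : ∀ v (Y : Submodule (ZMod p) (L v)), (∀ x, x ∈ Y ↔ ∀ y ∈ Y, B v x y = 0) →
      (B v).orthogonal Y = Y := fun v Y hY => by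
    ext x
    rw [LinearMap.BilinForm.mem_orthogonal_iff, hY x]
    exact forall₂_congr fun y _ => by rw [hsymm v]
  have hnd' : ∀ v, (B v).Nondegenerate := fun v =>
    (LinearMap.IsRefl.nondegenerate_iff_separatingLeft (hsymm' v).isRefl).mpr (hnd v)
  have hΛ' : ∀ v, v ∉ S₀ → (B v).orthogonal (Λ v) = Λ v := fun v hv => horth v _ (hΛ v hv)
  have hX' : ∀ v, v ∈ S → (B v).orthogonal (X v) = X v := fun v hv => horth v _ (hX v hv)
  have hex : ∀ v, ∃ Y : Submodule (ZMod p) (L v), (B v).orthogonal Y = Y := fun v => by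
    by_cases hv : v ∈ S
    · exact ⟨X v, hX' v hv⟩
    · exact ⟨Λ v, hΛ' v fun h => hv (hS₀ h)⟩
  have hsum : ∀ S' : Finset ι, S₀ ⊆ S' → ∀ c : H, (∀ v, v ∉ S' → loc v c ∈ Λ v) →
      ∑ v ∈ S', B v (loc v c) (loc v c) = 0 := fun S' hS' c hc => hrec S' hS' c c hc hc
  let 𝓆 := GlobalMetabolicStructure.ofPairings loc Λ S₀ B hsymm' h2 hnd' hex hΛ' hsum
  refine ⟨𝓆, QuadraticSelmerStructure.ofSelfDual hsymm' h2 hnd' hex hΛ' hsum S hS₀ X hX', ?_, rfl,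
    fun v hv => ofSelfDual_W_of_mem hsymm' h2 hnd' hex hΛ' hsum S hS₀ X hX' hv, ?_⟩
  · -- Poitou–Tate: `Z^⊥ = Z`
    rw [isSelfDualAt_ofPairings_iff]
    intro y
    constructor
    · intro hy
      -- extend `y` by `0` off `S` and apply `hPT`
      obtain ⟨c, hc, hcy⟩ := hPT (fun v => if h : v ∈ S then y ⟨v, h⟩ else 0) fun c hc => by
        have h := hy (locPi loc S c) (Submodule.mem_map.mpr
          ⟨c, (mem_unramifiedOutside_iff loc Λ S c).mpr hc, rfl⟩)
        rw [← Finset.sum_coe_sort S]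
        refine (Finset.sum_congr rfl fun v _ => ?_).trans h
        rw [locPi_apply, dif_pos v.2]
      refine Submodule.mem_map.mpr ⟨c, (mem_unramifiedOutside_iff loc Λ S c).mpr hc, funext fun v => ?_⟩
      rw [locPi_apply, hcy v v.2, dif_pos v.2]
    · intro hy z hz
      obtain ⟨c, hc, rfl⟩ := Submodule.mem_map.mp hz
      obtain ⟨d, hd, rfl⟩ := Submodule.mem_map.mp hy
      simp only [locPi_apply]
      rw [Finset.sum_coe_sort S fun v => B v (loc v c) (loc v d)]
      exact hrec S hS₀ c d ((mem_unramifiedOutside_iff loc Λ S c).mp hc)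
        ((mem_unramifiedOutside_iff loc Λ S d).mp hd)
  · -- finiteness
    haveI : Finite (unramifiedOutside loc Λ S) :=
      Finite.of_equiv _ (Equiv.subtypeEquivRight fun c => (mem_unramifiedOutside_iff loc Λ S c).symm)
    exact Module.Finite.of_finite

end Structures

/-! ### §2. One setup for (P) and (G): the structures of the group data and the two Selmer groups -/

section GroupForm

variable {p : ℕ} [hp : Fact p.Prime] {ι : Type v} [DecidableEq ι] {H : Type w} [AddCommGroup H]
  {L : ι → Type x} [∀ v, AddCommGroup (L v)] [∀ v, Finite (L v)]

/-- **The common engine of (P) and (G) in group currency**: under the group-currency inputs (module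
docstring), (P) for every exceptional set `T` and (G) at every single exceptional place `v₀`, read off
files 2–3 through `exists_structures` (the `𝔽_p`-structures are chosen by `haveI`; only membership and
orders cross the bridge). The named corollaries are `even_add_add_card_groupForm`, `ne_bot_of_odd_groupForm`
(this file) and the (G) forms of `X10/ResidualSelmerGeneratorTestGroupForm.lean`.
[cite: MazurRubin2007, Prop. 1.3 (i) and Thm. 1.4] [cite: KlagsbrunMazurRubin2013, Thm. 3.9] -/
theorem even_and_generatorTest_groupForm (hp2 : p ≠ 2) (hH : ∀ c : H, p • c = 0) (hL : ∀ v, ∀ x : L v, p • x = 0)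
    (loc : ∀ v, H →+ L v) (Λ : ∀ v, AddSubgroup (L v)) (b : ∀ v, L v →+ L v →+ ZMod p)
    {S₀ P S : Finset ι} (X : ∀ v, AddSubgroup (L v))
    (hsymm : ∀ v x y, b v x y = b v y x) (hnd : ∀ v x, (∀ y, b v x y = 0) → x = 0)
    (hΛ : ∀ v, v ∉ S₀ → ∀ x, x ∈ Λ v ↔ ∀ y ∈ Λ v, b v x y = 0)
    (hX : ∀ v ∈ S, ∀ x, x ∈ X v ↔ ∀ y ∈ X v, b v x y = 0)
    (hrec : ∀ S' : Finset ι, S₀ ⊆ S' → ∀ c d : H, (∀ v, v ∉ S' → loc v c ∈ Λ v) →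
      (∀ v, v ∉ S' → loc v d ∈ Λ v) → ∑ v ∈ S', b v (loc v c) (loc v d) = 0)
    (hPT : ∀ y : ∀ v, L v, (∀ c : H, (∀ v, v ∉ S → loc v c ∈ Λ v) →
      ∑ v ∈ S, b v (loc v c) (y v) = 0) → ∃ c : H, (∀ v, v ∉ S → loc v c ∈ Λ v) ∧ ∀ v ∈ S, loc v c = y v)
    (hfin : Finite {c : H // ∀ v, v ∉ S → loc v c ∈ Λ v}) (hS₀P : S₀ ⊆ P) (hPS : P ⊆ S)
    (Sel S0 : AddSubgroup H)
    (hSel : ∀ c, c ∈ Sel ↔ (∀ v ∈ S, loc v c ∈ X v) ∧ ∀ v, v ∉ S → loc v c ∈ Λ v)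
    (hS0 : ∀ c, c ∈ S0 ↔ (∀ v ∈ P, loc v c ∈ X v) ∧ ∀ v, v ∉ P → loc v c ∈ Λ v) :
    (∀ (T : Finset ι) (s s₀ : ℕ), T ⊆ S \ P → (∀ v ∈ S \ P, v ∉ T → X v = Λ v) →
        (∀ v ∈ T, Nat.card (X v) = p * Nat.card ↥(X v ⊓ Λ v)) →
        Nat.card Sel = p ^ s → Nat.card S0 = p ^ s₀ → Even (s + s₀ + T.card)) ∧
      ∀ (v₀ : ι) (c : H), v₀ ∈ S \ P → (∀ v ∈ S \ P, v ≠ v₀ → X v = Λ v) →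
        Nat.card (X v₀) = p * Nat.card ↥(X v₀ ⊓ Λ v₀) → Nat.card Sel = p → c ∈ Sel → c ≠ 0 →
        (loc v₀ c ∉ Λ v₀ → S0 = ⊥) ∧ (loc v₀ c ∈ Λ v₀ → Nat.card S0 = p ^ 2) := by
  -- `haveI`, not `letI`: an opaque `𝔽_p`-structure is all that is used (and `letI` with the implicit
  -- modulus leaves instance search stuck)
  haveI : Module (ZMod p) H := AddCommGroup.zmodModule hH
  haveI : ∀ v, Module (ZMod p) (L v) := fun v => AddCommGroup.zmodModule (hL v)
  choose B hB using fun v => exists_bilinForm_eq (b v)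
  obtain ⟨𝓆, 𝒮, hPT', hplaces, hW, hfin'⟩ := exists_structures hp2
    (fun v => (loc v).toZModLinearMap p) (fun v => AddSubgroup.toZModSubmodule p (Λ v)) B
    (hS₀P.trans hPS) (fun v => AddSubgroup.toZModSubmodule p (X v))
    (fun v x y => by rw [hB, hB, hsymm]) (fun v x hx => hnd v x fun y => by rw [← hB]; exact hx y)
    (fun v hv x => by
      simpa only [AddSubgroup.mem_toZModSubmodule, AddMonoidHom.coe_toZModLinearMap, hB] using hΛ v hv x)
    (fun v hv x => by
      simpa only [AddSubgroup.mem_toZModSubmodule, AddMonoidHom.coe_toZModLinearMap, hB] using hX v hv x)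
    (fun S' hS' c d hc hd => by
      simpa only [AddMonoidHom.coe_toZModLinearMap, hB] using hrec S' hS' c d hc hd)
    (fun y hy => hPT y fun c hc => by simpa only [AddMonoidHom.coe_toZModLinearMap, hB] using hy c hc)
    hfin
  have hS : 𝒮.places ⊆ S := hplaces.le
  -- local conditions off `P`, local term one, in file 2's words
  have hoff' : ∀ {v}, v ∈ S \ P → X v = Λ v → 𝒮.W v = AddSubgroup.toZModSubmodule p (Λ v) :=
    fun {v} hv h => by rw [hW v (Finset.mem_sdiff.mp hv).1, h]
  have hone : ∀ {v}, v ∈ S \ P → Nat.card (X v) = p * Nat.card ↥(X v ⊓ Λ v) →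
      finrank (ZMod p) (𝒮.W v) = finrank (ZMod p) ↥(𝒮.W v ⊓ AddSubgroup.toZModSubmodule p (Λ v)) + 1 :=
    fun {v} hv h => by
    rw [hW v (Finset.mem_sdiff.mp hv).1]
    exact finrank_eq_finrank_inf_add_one_of_natCard h
  -- the two Selmer groups, by membership
  have hSel' : ∀ c : H, c ∈ (𝒮.selmerGroup : Submodule (ZMod p) H) ↔ c ∈ Sel := fun c => by
    rw [QuadraticSelmerStructure.mem_selmerGroup_iff, hSel]
    refine ⟨fun h => ⟨fun v hv => ?_, fun v hv => ?_⟩, fun h v => ?_⟩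
    · simpa only [hW v hv, AddSubgroup.mem_toZModSubmodule, AddMonoidHom.coe_toZModLinearMap] using h v
    · simpa only [𝒮.eq_unramified v fun h' => hv (hS h'), AddSubgroup.mem_toZModSubmodule,
        AddMonoidHom.coe_toZModLinearMap] using h v
    · by_cases hv : v ∈ S
      · simpa only [hW v hv, AddSubgroup.mem_toZModSubmodule, AddMonoidHom.coe_toZModLinearMap]
          using h.1 v hv
      · simpa only [𝒮.eq_unramified v fun h' => hv (hS h'), AddSubgroup.mem_toZModSubmodule,
          AddMonoidHom.coe_toZModLinearMap] using h.2 v hv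
  have hS0' : ∀ c : H, c ∈ ((residual 𝒮 P hS₀P).selmerGroup : Submodule (ZMod p) H) ↔ c ∈ S0 :=
      fun c => by
    rw [mem_residual_selmerGroup_iff, hS0]
    refine ⟨fun h => ⟨fun v hv => ?_, h.2⟩, fun h => ⟨fun v hv => ?_, h.2⟩⟩
    · simpa only [hW v (hPS hv), AddSubgroup.mem_toZModSubmodule, AddMonoidHom.coe_toZModLinearMap]
        using h.1 v hv
    · simpa only [hW v (hPS hv), AddSubgroup.mem_toZModSubmodule, AddMonoidHom.coe_toZModLinearMap]
        using h.1 v hv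
  have eSel := natCard_eq_of_forall_mem_iff hSel'
  have eS0 := natCard_eq_of_forall_mem_iff hS0'
  refine ⟨fun T s s₀ hTS hoff hT hs hs₀ => ?_, fun v₀ c hv₀ hoff hv₀d hcard hc hc0 => ⟨fun hcv => ?_, fun hcv => ?_⟩⟩
  · exact ResidualSelmerParity.even_add_add_card_of_natCard_eq_pow 𝒮 hS₀P hPS hS hTS
      (fun v hv hvT => hoff' hv (hoff v hv hvT)) (fun v hv => hone (hTS hv) (hT v hv)) hfin' hPT'
      (eSel.trans hs) (eS0.trans hs₀)
  · have hres := natCard_residual_selmerGroup_eq_one_of_generator_not_mem 𝒮 hS₀P hPS hS hv₀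
      (fun v hv hne => hoff' hv (hoff v hv hne)) (hone hv₀ hv₀d) hfin' hPT' (eSel.trans hcard)
      ((hSel' c).mpr hc) hc0 hcv
    rw [eS0] at hres
    exact AddSubgroup.eq_bot_of_card_eq S0 hres
  · rw [← eS0]
    exact natCard_residual_selmerGroup_eq_sq_of_generator_mem 𝒮 hS₀P hPS hS hv₀
      (fun v hv hne => hoff' hv (hoff v hv hne)) (hone hv₀ hv₀d) hfin' hPT' (eSel.trans hcard)
      ((hSel' c).mpr hc) hc0 hcv

/-- **(P) — the Tamagawa-parity law in group currency** (Mazur–Rubin 2007 Thm. 1.4 for the structure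
`(X_v)` and its RESIDUAL structure, through files 2 and 4). For an odd prime `p`, `p`-torsion groups
`H`, `L v` with `loc v : H →+ L v`, subgroups `Λ v`, `X v`, bi-additive symmetric nondegenerate
`b v : L v →+ L v →+ ZMod p` with `Λ v` self-annihilating off `S₀` and `X v` self-annihilating on
`S ⊇ P ⊇ S₀`, Poitou–Tate in its two elementwise halves `hrec` / `hPT`, finitely many classes
unramified outside `S`, `X v = Λ v` on `S \ (P ∪ T)` and `#X_v = p · #(X_v ∩ Λ_v)` on `T ⊆ S \ P`:
if `#Sel = p^s` and `#S⁰ = p^{s₀}` then `s + s₀ + #T` is even. THE INSTANCE (P-INSTANCE-SPEC):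
`H = H¹(ℚ, E[3])`, `Sel = Sel₃(E)`, `S⁰ = S⁰(E)`, `T = T_E = {ℓ : 3 ∣ c_ℓ(E)}`:
`dim Sel₃(E) − dim S⁰(E) ≡ #T_E (mod 2)`. [cite: MazurRubin2007, Thm. 1.4]
[cite: KlagsbrunMazurRubin2013, Thm. 3.9] -/
theorem even_add_add_card_groupForm (hp2 : p ≠ 2) (hH : ∀ c : H, p • c = 0)
    (hL : ∀ v, ∀ x : L v, p • x = 0) (loc : ∀ v, H →+ L v) (Λ : ∀ v, AddSubgroup (L v))
    (b : ∀ v, L v →+ L v →+ ZMod p) {S₀ P S T : Finset ι} (X : ∀ v, AddSubgroup (L v))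
    (hsymm : ∀ v x y, b v x y = b v y x) (hnd : ∀ v x, (∀ y, b v x y = 0) → x = 0)
    (hΛ : ∀ v, v ∉ S₀ → ∀ x, x ∈ Λ v ↔ ∀ y ∈ Λ v, b v x y = 0)
    (hX : ∀ v ∈ S, ∀ x, x ∈ X v ↔ ∀ y ∈ X v, b v x y = 0)
    (hrec : ∀ S' : Finset ι, S₀ ⊆ S' → ∀ c d : H, (∀ v, v ∉ S' → loc v c ∈ Λ v) →
      (∀ v, v ∉ S' → loc v d ∈ Λ v) → ∑ v ∈ S', b v (loc v c) (loc v d) = 0)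
    (hPT : ∀ y : ∀ v, L v, (∀ c : H, (∀ v, v ∉ S → loc v c ∈ Λ v) →
      ∑ v ∈ S, b v (loc v c) (y v) = 0) → ∃ c : H, (∀ v, v ∉ S → loc v c ∈ Λ v) ∧ ∀ v ∈ S, loc v c = y v)
    (hfin : Finite {c : H // ∀ v, v ∉ S → loc v c ∈ Λ v})
    (hS₀P : S₀ ⊆ P) (hPS : P ⊆ S) (hTS : T ⊆ S \ P) (hoff : ∀ v ∈ S \ P, v ∉ T → X v = Λ v)
    (hT : ∀ v ∈ T, Nat.card (X v) = p * Nat.card ↥(X v ⊓ Λ v))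
    (Sel S0 : AddSubgroup H)
    (hSel : ∀ c, c ∈ Sel ↔ (∀ v ∈ S, loc v c ∈ X v) ∧ ∀ v, v ∉ S → loc v c ∈ Λ v)
    (hS0 : ∀ c, c ∈ S0 ↔ (∀ v ∈ P, loc v c ∈ X v) ∧ ∀ v, v ∉ P → loc v c ∈ Λ v)
    {s s₀ : ℕ} (hs : Nat.card Sel = p ^ s) (hs₀ : Nat.card S0 = p ^ s₀) :
    Even (s + s₀ + T.card) :=
  (even_and_generatorTest_groupForm hp2 hH hL loc Λ b X hsymm hnd hΛ hX hrec hPT hfin hS₀P hPS Sel S0 hSel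
    hS0).1 T s s₀ hTS hoff hT hs hs₀

/-- **(P), NO-GO form in group currency.** Under the hypotheses of `even_add_add_card_groupForm`,
`#Sel = p^s` with `s + #T` odd ⟹ `S⁰ ≠ ⊥`. THE INSTANCE: the 25 NOGO-parity cells of N2
(`#Sel₃(E) = 3^s` certified, `#T_E` from the Tate-algorithm certificate, `s + #T_E` odd) have
`S⁰(E) ≠ 0`, hence by (X) no Tamagawa-`3`-free good-at-`3` congruent unit curve. [cite: MazurRubin2007, Thm. 1.4] -/
theorem ne_bot_of_odd_groupForm (hp2 : p ≠ 2) (hH : ∀ c : H, p • c = 0)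
    (hL : ∀ v, ∀ x : L v, p • x = 0) (loc : ∀ v, H →+ L v) (Λ : ∀ v, AddSubgroup (L v))
    (b : ∀ v, L v →+ L v →+ ZMod p) {S₀ P S T : Finset ι} (X : ∀ v, AddSubgroup (L v))
    (hsymm : ∀ v x y, b v x y = b v y x) (hnd : ∀ v x, (∀ y, b v x y = 0) → x = 0)
    (hΛ : ∀ v, v ∉ S₀ → ∀ x, x ∈ Λ v ↔ ∀ y ∈ Λ v, b v x y = 0)
    (hX : ∀ v ∈ S, ∀ x, x ∈ X v ↔ ∀ y ∈ X v, b v x y = 0)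
    (hrec : ∀ S' : Finset ι, S₀ ⊆ S' → ∀ c d : H, (∀ v, v ∉ S' → loc v c ∈ Λ v) →
      (∀ v, v ∉ S' → loc v d ∈ Λ v) → ∑ v ∈ S', b v (loc v c) (loc v d) = 0)
    (hPT : ∀ y : ∀ v, L v, (∀ c : H, (∀ v, v ∉ S → loc v c ∈ Λ v) →
      ∑ v ∈ S, b v (loc v c) (y v) = 0) → ∃ c : H, (∀ v, v ∉ S → loc v c ∈ Λ v) ∧ ∀ v ∈ S, loc v c = y v)
    (hfin : Finite {c : H // ∀ v, v ∉ S → loc v c ∈ Λ v})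
    (hS₀P : S₀ ⊆ P) (hPS : P ⊆ S) (hTS : T ⊆ S \ P) (hoff : ∀ v ∈ S \ P, v ∉ T → X v = Λ v)
    (hT : ∀ v ∈ T, Nat.card (X v) = p * Nat.card ↥(X v ⊓ Λ v))
    (Sel S0 : AddSubgroup H)
    (hSel : ∀ c, c ∈ Sel ↔ (∀ v ∈ S, loc v c ∈ X v) ∧ ∀ v, v ∉ S → loc v c ∈ Λ v)
    (hS0 : ∀ c, c ∈ S0 ↔ (∀ v ∈ P, loc v c ∈ X v) ∧ ∀ v, v ∉ P → loc v c ∈ Λ v)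
    {s : ℕ} (hs : Nat.card Sel = p ^ s) (hodd : Odd (s + T.card)) : S0 ≠ ⊥ := by
  intro hbot
  have h0 : Nat.card S0 = p ^ 0 := by rw [hbot, pow_zero]; exact Nat.card_unique
  have h := even_add_add_card_groupForm hp2 hH hL loc Λ b X hsymm hnd hΛ hX hrec hPT hfin hS₀P hPS hTS
    hoff hT Sel S0 hSel hS0 hs h0
  rw [add_zero] at h
  exact (Nat.not_even_iff_odd.mpr hodd) h

end GroupForm

end Summit.BirchSwinnertonDyer.Rank1Residual.X10.ResidualSelmerParityGroupForm

end
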